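import Literature.RingTheory.SimpleModule.MultiplicityFreeImage
import Mathlib.RingTheory.Adjoin.Basic
import HarnessLib

/-!
# The image of an algebra acting multiplicity-freely — subalgebra and generating-family editions

Topic `Literature/RingTheory/SimpleModule` (namespace `Literature.RingTheory.SimpleModule`), companion of ★ `MultiplicityFreeImage` («(B-mf)»:
`finrank_center_mul_finrank_range_lsmul_eq_sq`).  THEOREMS ONLY (Mathlib + that file; no definition, no named fact, no instance, no `sorry`).

F. Lorenz, *Algebra II* (2008), Ch. 28, F20 (Jacobson density with Schur over an algebraically closed field), as used by [Liu2021] App. D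
Prop. D.4 (1) / §D.4: if a subalgebra `S ⊆ End_K(W)` (`K` algebraically closed, `W` finite-dimensional) acts SEMISIMPLY and MULTIPLICITY-FREELY
with all simple constituents of one dimension `d`, then `dim_K Z(S) · dim_K S = (dim_K W)²`, `Z(S) := S ⊓ C(S)`.  ★ (B-mf) states this for an
ABSTRACT `K`-algebra `A` acting on `W` and the image `(lsmul : A → End_K W).range`; here it is read for `A := S` itself (Mathlib's tautological
`Module ↥S W`, under which `lsmul` has range `S`) and for `S := K⟨a⟩`, the subalgebra generated by a family of endomorphisms `a : I → End_K W` —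
the currency of the (MO) socket of the d6 S2′ degree road (★ `ComplexMultiplication/BlockDimensionIdentityOfTateComparison`,
`finrank_mul_finrank_range_eq_sq_of_exists_block`, binder `hMO`).

* `range_lsmul_subalgebra` — `(Algebra.lsmul K K W : ↥S →ₐ[K] End_K W).range = S`.
* `finrank_center_mul_finrank_eq_sq_of_subalgebra` — (B-mf) for the tautological `↥S`-module `W`.
* `finrank_center_mul_finrank_adjoin_eq_sq_of_multiplicityFree` — the same with `S := K⟨a⟩`, i.e. the (MO) socket's last conjunct.

Cell `hodgecm-mathlib`, crux `HLiu418` = stmt-HodgeConjecture-24832; moves no book (HC_CM is proved only modulo the 7 printed citations until rung 0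
closes).

## References
* [Lorenz2008] F. Lorenz, *Algebra II: Fields with Structure, Algebras and Advanced Topics*, Springer (2008), Ch. 28, F20.
* [Liu2021] Y. Liu, *Fourier–Jacobi cycles and arithmetic relative trace formula*, Camb. J. Math. 9 (2021), App. D Prop. D.4 (1) (p. 130), §D.4
  (FJcycle.tex l. 5626–5627).
-/

set_option autoImplicit false

namespace Literature.RingTheory.SimpleModule

open Module

section Subalgebra

variable {K : Type*} [Field K] {W : Type*} [AddCommGroup W] [Module K W] (S : Subalgebra K (Module.End K W))

/-- **The tautological action of a subalgebra `S ⊆ End_K W` has image `S`**: `(lsmul : ↥S → End_K W).range = S` (Mathlib's `Module ↥S W` is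
`s • w = s w`). [cite: Lorenz2008, Ch. 28 F20 (the image of the acting algebra)] -/
theorem range_lsmul_subalgebra : (Algebra.lsmul K K W : ↥S →ₐ[K] Module.End K W).range = S := by
  ext f
  constructor
  · rintro ⟨s, rfl⟩
    have hs : (Algebra.lsmul K K W : ↥S →ₐ[K] Module.End K W) s = (s : Module.End K W) := LinearMap.ext fun _ => rfl
    change (Algebra.lsmul K K W : ↥S →ₐ[K] Module.End K W) s ∈ S
    rw [hs]
    exact s.2
  · intro hf
    exact ⟨⟨f, hf⟩, LinearMap.ext fun _ => rfl⟩

/-- **(B-mf) for a subalgebra acting tautologically: `dim_K Z(S) · dim_K S = (dim_K W)²`** when `W` is a semisimple, multiplicity-free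
`↥S`-module whose simple constituents all have `K`-dimension `d` (`K` algebraically closed).
[cite: Lorenz2008, Ch. 28 F20 (Jacobson density with Schur's lemma)] [cite: Liu2021, App. D Prop. D.4 (1) (p. 130) and §D.4 (FJcycle.tex l. 5626–5627)] -/
theorem finrank_center_mul_finrank_eq_sq_of_subalgebra [IsAlgClosed K] [FiniteDimensional K W] [IsSemisimpleModule ↥S W]
    [Fintype (isotypicComponents ↥S W)] (hmf : ∀ c : isotypicComponents ↥S W, IsSimpleModule ↥S (c : Submodule ↥S W)) {d : ℕ}
    (hd : ∀ c : isotypicComponents ↥S W, finrank K (c : Submodule ↥S W) = d) :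
    finrank K ↥(S ⊓ Subalgebra.centralizer K (S : Set (Module.End K W))) * finrank K ↥S = finrank K W ^ 2 := by
  have h := finrank_center_mul_finrank_range_lsmul_eq_sq (K := K) (A := ↥S) (V := W) hmf hd
  rwa [range_lsmul_subalgebra] at h

end Subalgebra

section Adjoin

variable {K : Type*} [Field K] {W : Type*} [AddCommGroup W] [Module K W] {I : Type*} (a : I → Module.End K W)

/-- **(B-mf) for the subalgebra `K⟨a⟩` generated by a family of endomorphisms** — the last conjunct of the (MO) socket of ★
`BlockDimensionIdentityOfTateComparison.finrank_mul_finrank_range_eq_sq_of_exists_block`, from multiplicity-freeness of `W` as a module over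
the tautological `↥(K⟨a⟩)`. [cite: Lorenz2008, Ch. 28 F20 (Jacobson density with Schur's lemma)] [cite: Liu2021, App. D Prop. D.4 (1) (p. 130) and §D.4 (FJcycle.tex l. 5626–5627)] -/
theorem finrank_center_mul_finrank_adjoin_eq_sq_of_multiplicityFree [IsAlgClosed K] [FiniteDimensional K W]
    [IsSemisimpleModule ↥(Algebra.adjoin K (Set.range a)) W] [Fintype (isotypicComponents ↥(Algebra.adjoin K (Set.range a)) W)]
    (hmf : ∀ c : isotypicComponents ↥(Algebra.adjoin K (Set.range a)) W,
      IsSimpleModule ↥(Algebra.adjoin K (Set.range a)) (c : Submodule ↥(Algebra.adjoin K (Set.range a)) W))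
    {d : ℕ} (hd : ∀ c : isotypicComponents ↥(Algebra.adjoin K (Set.range a)) W,
      finrank K (c : Submodule ↥(Algebra.adjoin K (Set.range a)) W) = d) :
    finrank K ↥(Algebra.adjoin K (Set.range a) ⊓
          Subalgebra.centralizer K (Algebra.adjoin K (Set.range a) : Set (Module.End K W))) *
        finrank K ↥(Algebra.adjoin K (Set.range a)) = finrank K W ^ 2 :=
  finrank_center_mul_finrank_eq_sq_of_subalgebra (Algebra.adjoin K (Set.range a)) hmf hd

end Adjoin

end Literature.RingTheory.SimpleModule
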